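import Mathlib.Tactic.LinearCombination
import Mathlib.Tactic.Ring
import Literature.Computability.MetaComplexity.ParityModTestCosetDensity
import HarnessLib

/-!
# Free-core reduction for families of affine `MOD₃` tests sharing a reference form

SETTING (`ParityModTestCosetDensity`): affine `MOD₃` tests on the cube `{0,1}^z`, the fired-parity
`parityMod3 β r u = [#{g : ⟨β_g,u⟩ ≢ r_g} odd]`, and the parity cosets `H_ε = parityCoset z ε`.

THEOREM (`freeCoreReduction`; typed verbatim by the cell qa-qnc0 as `AffBells35.FreeCoreReduction`,
ROUND-34 §12.10(n)(ii) — the combinatorial heart of the bookkeeping theorem).  Tests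
`[e_g·σ(u) + μ_g(u) ≢ r_g]` sharing a reference form `σ` (signs `e_g`, junta deviations `μ_g`); a FREE
CORE `Fr` of `≥ 6` coordinates where `σ ≠ 0` and every `μ_g` vanishes.  If the fired-parity is a constant
`κ` on `H_ε`, then for EVERY value `t` substituted for the free part of `σ` the tests
`[e_g t + e_g σ|_{Frᶜ}(u) + μ_g(u) ≢ r_g]` have the same constant fired-parity `κ` on `H_ε`.

PROOF.  The free coins realise every `t ∈ ℤ₃` inside each parity class: among `≥ 6` non-zero values one
value `a` occurs `≥ 3` times, and `k` coins of value `a` plus `j` coins of value `2a` give every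
(sum, size-parity) pair (`exists_subset_sum_card_mod_two`); so for `u ∈ H_ε` there is `u′ ∈ H_ε` agreeing
with `u` off `Fr` with `σ|_{Fr}(u′) = t`, and the substituted tests at `u` are the original tests at `u′`.

Printed relative: programs over groups / `MOD₂∘MOD₃` circuits [BarringtonStraubingTherien1990, §6]; the
statement is SUPPLIED HERE (consumer: qa-qnc0 ROUND-34 §12.10(n)).  No named facts.
-/

namespace Literature.Computability.MetaComplexity

open Finset
open Literature.Computability.MetaComplexity.ParityModTestDensity

namespace FreeCore

variable {z : ℕ}

/-! ### 1. Subset sums of non-zero values in `ℤ₃` -/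

/-- `k` coins of value `a` and `j` coins of value `2a`, chosen inside disjoint pools. [folklore] -/
private theorem exists_subset_of_pools (σ : Fin z → ZMod 3) (A B : Finset (Fin z)) (a : ZMod 3)
    (hA : ∀ i ∈ A, σ i = a) (hB : ∀ i ∈ B, σ i = 2 * a) (hAB : Disjoint A B) {k j : ℕ}
    (hk : k ≤ A.card) (hj : j ≤ B.card) :
    ∃ S ⊆ A ∪ B, S.card = k + j ∧ ∑ i ∈ S, σ i = (k : ZMod 3) * a + (j : ZMod 3) * (2 * a) := by
  classical
  obtain ⟨SA, hSA, hSAc⟩ := exists_subset_card_eq hk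
  obtain ⟨SB, hSB, hSBc⟩ := exists_subset_card_eq hj
  have hdisj : Disjoint SA SB := by
    rw [Finset.disjoint_left]
    intro i hiA hiB
    exact Finset.disjoint_left.1 hAB (hSA hiA) (hSB hiB)
  refine ⟨SA ∪ SB, union_subset_union hSA hSB, by rw [card_union_of_disjoint hdisj, hSAc, hSBc], ?_⟩
  rw [sum_union hdisj, sum_congr rfl fun i hi => hA i (hSA hi), sum_congr rfl fun i hi => hB i (hSB hi),
    sum_const, sum_const, hSAc, hSBc, nsmul_eq_mul, nsmul_eq_mul]

/-- **Subset sums.**  Among `≥ 6` non-zero values in `ℤ₃`, every target `t` is a subset sum with subset size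
of any prescribed parity. [folklore] -/
private theorem exists_subset_sum_card_mod_two (σ : Fin z → ZMod 3) (Fr : Finset (Fin z))
    (hFr : 6 ≤ Fr.card) (hσ : ∀ i ∈ Fr, σ i ≠ 0) (t : ZMod 3) (p : ℕ) :
    ∃ S ⊆ Fr, S.card % 2 = p % 2 ∧ ∑ i ∈ S, σ i = t := by
  classical
  -- one non-zero value a occurs at least three times
  obtain ⟨a, ha0, hA3⟩ : ∃ a : ZMod 3, a ≠ 0 ∧ 3 ≤ (Fr.filter fun i => σ i = a).card := by
    have hsplit : (Fr.filter fun i => σ i = 1).card + (Fr.filter fun i => σ i = 2).card = Fr.card := by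
      rw [← card_union_of_disjoint]
      · congr 1; ext i
        simp only [mem_union, mem_filter]
        constructor
        · rintro (⟨h, _⟩ | ⟨h, _⟩) <;> exact h
        · intro hi
          have h0 := hσ i hi
          have : σ i = 1 ∨ σ i = 2 := by
            have key : ∀ x : ZMod 3, x ≠ 0 → x = 1 ∨ x = 2 := by decide
            exact key _ h0
          rcases this with h | h
          · exact Or.inl ⟨hi, h⟩
          · exact Or.inr ⟨hi, h⟩
      · rw [Finset.disjoint_left]
        intro i h1 h2
        have e1 := (mem_filter.1 h1).2
        have e2 := (mem_filter.1 h2).2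
        rw [e1] at e2; exact absurd e2 (by decide)
    by_cases h1 : 3 ≤ (Fr.filter fun i => σ i = 1).card
    · exact ⟨1, by decide, h1⟩
    · exact ⟨2, by decide, by omega⟩
  set A := Fr.filter fun i => σ i = a with hAdef
  set B := Fr.filter fun i => σ i = 2 * a with hBdef
  have hA : ∀ i ∈ A, σ i = a := fun i hi => (mem_filter.1 hi).2
  have hB : ∀ i ∈ B, σ i = 2 * a := fun i hi => (mem_filter.1 hi).2
  have hAB : Disjoint A B := by
    rw [Finset.disjoint_left]
    intro i hiA hiB
    have e1 := hA i hiA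
    have e2 := hB i hiB
    rw [e1] at e2
    have key : ∀ x : ZMod 3, x ≠ 0 → x ≠ 2 * x := by decide
    exact key a ha0 e2
  have hABF : A ∪ B ⊆ Fr := union_subset (filter_subset _ _) (filter_subset _ _)
  -- every coin of Fr is in A or B, so |A| + |B| = |Fr|
  have hcard : A.card + B.card = Fr.card := by
    rw [← card_union_of_disjoint hAB]
    refine congrArg _ (Subset.antisymm hABF fun i hi => ?_)
    have key : ∀ x y : ZMod 3, x ≠ 0 → y ≠ 0 → x = y ∨ x = 2 * y := by decide
    rcases key _ a (hσ i hi) ha0 with h | h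
    · exact mem_union_left _ (mem_filter.2 ⟨hi, h⟩)
    · exact mem_union_right _ (mem_filter.2 ⟨hi, h⟩)
  -- the target is 0, a or 2a
  have ht : t = 0 ∨ t = a ∨ t = 2 * a := by
    have key : ∀ x y : ZMod 3, y ≠ 0 → x = 0 ∨ x = y ∨ x = 2 * y := by decide
    exact key t a ha0
  -- produce (k, j) in each of the six cases
  have h3z : (3 : ZMod 3) = 0 := by decide
  have main : ∃ k j : ℕ, k ≤ A.card ∧ j ≤ B.card ∧ (k + j) % 2 = p % 2 ∧
      (k : ZMod 3) * a + (j : ZMod 3) * (2 * a) = t := by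
    rcases Nat.mod_two_eq_zero_or_one p with hp | hp <;> rw [hp] <;> rcases ht with h | h | h <;> rw [h]
    · exact ⟨0, 0, by omega, by omega, by norm_num, by push_cast; ring⟩
    · by_cases h4 : 4 ≤ A.card
      · exact ⟨4, 0, h4, by omega, by norm_num, by push_cast; linear_combination a * h3z⟩
      · exact ⟨0, 2, by omega, by omega, by norm_num, by push_cast; linear_combination a * h3z⟩
    · exact ⟨2, 0, by omega, by omega, by norm_num, by push_cast; ring⟩
    · exact ⟨3, 0, hA3, by omega, by norm_num, by push_cast; linear_combination a * h3z⟩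
    · exact ⟨1, 0, by omega, by omega, by norm_num, by push_cast; ring⟩
    · by_cases hB1 : 1 ≤ B.card
      · exact ⟨0, 1, by omega, hB1, by norm_num, by push_cast; ring⟩
      · exact ⟨5, 0, by omega, by omega, by norm_num, by push_cast; linear_combination a * h3z⟩
  obtain ⟨k, j, hk, hj, hkj, hsum⟩ := main
  obtain ⟨S, hS, hSc, hSs⟩ := exists_subset_of_pools σ A B a hA hB hAB hk hj
  exact ⟨S, hS.trans hABF, by rw [hSc, hkj], by rw [hSs, hsum]⟩

/-! ### 2. The reduction -/

/-- **Free-core reduction (typed `AffBells35.FreeCoreReduction` verbatim).**  Tests `[e_g σ(u) + μ_g(u) ≢ r_g]`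
with a free core `Fr` (`|Fr| ≥ 6`, `σ ≠ 0` on `Fr`, all `μ_g` vanish on `Fr`) and constant fired-parity `κ`
on `H_ε`: for every `t : ℤ₃` the tests with the free part of `σ` replaced by `t`,
`[e_g σ|_{Frᶜ}(u) + μ_g(u) ≢ r_g − e_g t]`, have fired-parity `κ` on `H_ε`.
[cite: BarringtonStraubingTherien1990, §6 (MOD₂∘MOD₃ programs on the cube); statement and proof supplied
here (qa-qnc0 ROUND-34 §12.10(n)(ii))] -/
theorem freeCoreReduction (s z : ℕ) (σ : Fin z → ZMod 3) (e : Fin s → ZMod 3)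
    (μ : Fin s → Fin z → ZMod 3) (r : Fin s → ZMod 3) (ε : Bool) (Fr : Finset (Fin z)) (κ : Bool)
    (hFr : 6 ≤ Fr.card) (hσ : ∀ i ∈ Fr, σ i ≠ 0) (hμ : ∀ g, ∀ i ∈ Fr, μ g i = 0)
    (hconst : ∀ u ∈ parityCoset z ε, parityMod3 (fun g i => e g * σ i + μ g i) r u = κ) :
    ∀ t : ZMod 3, ∀ u ∈ parityCoset z ε,
      parityMod3 (fun g i => (if i ∈ Fr then 0 else e g * σ i) + μ g i) (fun g => r g - e g * t) u = κ := by
  classical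
  intro t u hu
  -- a free subset with sum t and the right size parity
  obtain ⟨S, hSF, hSc, hSs⟩ :=
    exists_subset_sum_card_mod_two σ Fr hFr hσ t (Fr.filter fun i => u i = true).card
  -- the modified point: u off Fr, the indicator of S on Fr
  let u' : Fin z → Bool := fun i => if i ∈ Fr then decide (i ∈ S) else u i
  -- bookkeeping: sums over Fr and over its complement
  have hFr_eq : univ.filter (fun i : Fin z => i ∈ Fr) = Fr := by ext i; simp
  have hsplit : ∀ (f : Fin z → ZMod 3), ∑ i, f i
      = ∑ i ∈ Fr, f i + ∑ i ∈ univ.filter (fun i => ¬ i ∈ Fr), f i := by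
    intro f
    rw [← Finset.sum_filter_add_sum_filter_not univ (fun i => i ∈ Fr), hFr_eq]
  have hsplitN : ∀ (f : Fin z → ℕ), ∑ i, f i
      = ∑ i ∈ Fr, f i + ∑ i ∈ univ.filter (fun i => ¬ i ∈ Fr), f i := by
    intro f
    rw [← Finset.sum_filter_add_sum_filter_not univ (fun i => i ∈ Fr), hFr_eq]
  have hu'_on : ∀ i ∈ Fr, u' i = decide (i ∈ S) := fun i hi => by simp [u', hi]
  have hu'_off : ∀ i ∈ univ.filter (fun i => ¬ i ∈ Fr), u' i = u i := fun i hi => by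
    simp [u', (mem_filter.1 hi).2]
  -- u' lies in the same parity coset
  have hu' : u' ∈ parityCoset z ε := by
    have hmem : ∀ v : Fin z → Bool, v ∈ parityCoset z ε ↔
        decide (Odd (∑ i, if v i = true then 1 else 0)) = ε := by
      intro v; simp only [parityCoset, mem_filter, mem_univ, true_and, Finset.card_filter]
    rw [hmem] at hu ⊢
    rw [← hu, decide_eq_decide]
    rw [hsplitN, hsplitN (fun i => if u i = true then 1 else 0)]
    have h1 : (∑ i ∈ Fr, if u' i = true then 1 else 0) = S.card := by
      rw [sum_congr rfl fun i hi => by rw [hu'_on i hi]]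
      rw [← card_filter]
      congr 1
      ext i; simp only [mem_filter, decide_eq_true_eq]
      exact ⟨fun h => h.2, fun h => ⟨hSF h, h⟩⟩
    have h2 : (∑ i ∈ univ.filter (fun i => ¬ i ∈ Fr), if u' i = true then 1 else 0)
        = ∑ i ∈ univ.filter (fun i => ¬ i ∈ Fr), if u i = true then 1 else 0 :=
      sum_congr rfl fun i hi => by rw [hu'_off i hi]
    have h3 : (∑ i ∈ Fr, if u i = true then 1 else 0) = (Fr.filter fun i => u i = true).card := by
      rw [card_filter]
    rw [h1, h2, h3, Nat.odd_iff, Nat.odd_iff, Nat.add_mod, hSc, ← Nat.add_mod]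
  -- the substituted form at u is the original form at u', shifted by e_g t
  have hlin : ∀ g : Fin s,
      (∑ i, if u' i then e g * σ i + μ g i else 0)
        = (∑ i, if u i then (if i ∈ Fr then 0 else e g * σ i) + μ g i else 0) + e g * t := by
    intro g
    rw [hsplit, hsplit (fun i => if u i then (if i ∈ Fr then 0 else e g * σ i) + μ g i else 0)]
    have h1 : (∑ i ∈ Fr, if u' i then e g * σ i + μ g i else 0) = e g * t := by
      rw [sum_congr rfl fun i hi => by rw [hu'_on i hi, hμ g i hi, add_zero]]
      rw [← hSs, mul_sum, ← sum_filter]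
      congr 1
      ext i; simp only [mem_filter, decide_eq_true_eq]
      exact ⟨fun h => h.2, fun h => ⟨hSF h, h⟩⟩
    have h2 : (∑ i ∈ Fr, if u i then (if i ∈ Fr then 0 else e g * σ i) + μ g i else 0) = 0 :=
      sum_eq_zero fun i hi => by rw [if_pos hi, hμ g i hi, add_zero]; simp
    have h3 : (∑ i ∈ univ.filter (fun i => ¬ i ∈ Fr), if u' i then e g * σ i + μ g i else 0)
        = ∑ i ∈ univ.filter (fun i => ¬ i ∈ Fr),
            if u i then (if i ∈ Fr then 0 else e g * σ i) + μ g i else 0 :=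
      sum_congr rfl fun i hi => by rw [hu'_off i hi, if_neg (mem_filter.1 hi).2]
    rw [h1, h2, h3]; ring
  -- the fired sets coincide
  rw [← hconst u' hu']
  have hfilter : (univ.filter fun g : Fin s =>
        (∑ i, if u i then (if i ∈ Fr then 0 else e g * σ i) + μ g i else 0) ≠ r g - e g * t)
      = univ.filter fun g : Fin s => (∑ i, if u' i then e g * σ i + μ g i else 0) ≠ r g := by
    refine filter_congr fun g _ => ?_
    rw [hlin g]
    exact Iff.not eq_sub_iff_add_eq
  unfold parityMod3
  simp only [hfilter]

end FreeCore

end Literature.Computability.MetaComplexity
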